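import Literature.Computability.Complexity.CountZerosModTwoPow
import Literature.Computability.Complexity.CodeFPBudgets
import Mathlib.Data.ZMod.Basic
import HarnessLib

/-!
# Proof of `Wan2008_countZerosModTwoPow_polyTime` (Wan 2008, Thm. 1.1 at `q = p = 2`, `h = 1`)

Discharge of the named fact of `CountZerosModTwoPow.lean`: for every fixed `b`, the map
`⟨1ⁿ, f⟩ ↦ N(f) mod 2^b` (`f` a sparse polynomial over `𝔽₂`, given as its list of monomials, a
monomial being the list of the indices of its variables) is polynomial-time computable in the
tree's `TM2` sense (`PolyTimeComputable`).

## The printed proof and the road taken here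

Wan [Wan2007] proves Thm. 1.1 for general `q = p^h` through formula (1) (p. 5) expressing `N(f)` by
Gauss sums, the Stickelberger congruence (Thm. 3.1) to discard all but `O(m^{(h+b)p})` terms
modulo `p^b`, and the Gross–Koblitz formula (Thm. 3.2) to evaluate the surviving terms
(Algorithm 4.1, p. 9). None of this `p`-adic apparatus (Teichmüller lifts, `p`-adic `Γ`) is in
Mathlib. For the vendored case `q = p = 2` the earlier, elementary route that Wan recalls on
pp. 2–3 — the modulus-amplifying polynomials of Gopalan–Guruswami–Lipton
[GopalanGuruswamiLipton2007] (after Toda, Yao, Beigel–Tarui), time `O(n m^{2q^b})` — gives the same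
membership in `FP`, and that is the road formalized here, in its crudest form (amplifier of
degree `2^b` instead of the optimal one; only membership in `FP` for fixed `b` is claimed):

1. `F2Sparse.eval_eq_bodd`: `f(y)` is the parity of `s(y) = #{j : x^{V_j}(y) = 1}`.
2. `F2Sparse.natCast_pow_two_pow_eq` (the amplifier): `s^{2^b} ≡ (s mod 2) (mod 2^b)` for every
   `s : ℕ` (even `s`: `2^{2^b} ∣ s^{2^b}` and `b ≤ 2^b`; odd `s`: `2^b ∣ s^{2^b} − 1` by induction,
   `s^{2^{b+1}} − 1 = (s^{2^b} − 1)(s^{2^b} + 1)`).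
3. Hence `#{y : f(y) = 1} = Σ_y (s(y) mod 2) ≡ Σ_y s(y)^{2^b} (mod 2^b)`, and expanding the power,
   `Σ_y s(y)^K = Σ_{(j_1,…,j_K)} #{y : x^{V_{j_1}}(y) = ⋯ = x^{V_{j_K}}(y) = 1}` is a sum of `m^K`
   subcube counts (`F2Sparse.countP_iterate_tuples`, `F2Sparse.sum_countP`), each equal to
   `2^{#free variables}` or `0` (`F2Sparse.card_subcube_eq`, a `Fintype.piFinset` count). The
   `K`-tuples are enumerated as the `K`-th iterate of `L ↦ [U ++ M | U ∈ L, M ∈ f]` from `[ε]`.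
4. `F2Sparse.countZeros_mod_two_pow`: `N(f) mod 2^b = (2ⁿ + (2^b − 1)·A) mod 2^b` with `A` that sum
   (all-natural form of `2ⁿ − A`).
5. The right-hand side is a functional program in the typed polynomial-time algebra `CodeFP`
   (`CodeFP.lean`, `CodeFPArith.lean`, `CodeFPBudgets.lean`: `map`, `flatten`, `filter`, `all`,
   `urange`, `natPow`, `intSum`, `natMod`, …), the tuple step iterated `K = 2^b` times by
   `CodeFP.comp` (`Wan2008Proof.codeFP_main`); `CodeFP.polyTimeComputable` and the bridges
   `pairE_eq`, `listE_eq`, `unE_eq`, `natE_eq` to Mathlib's encodings give the fact verbatim. No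
   machine is written. This file declares theorems only.

## References

* D. Wan, *Modular counting of rational points over finite fields*, Found. Comput. Math. 8 (2008),
  597–605, Thm. 1.1, pp. 2–3 (the case `q = p` and the GGL algorithm), Algorithm 4.1. [Wan2007]
* P. Gopalan, V. Guruswami, R. J. Lipton, *Algorithms for modular counting of roots of multivariate
  polynomials*, Algorithmica 50 (2008), 479–496 (modulus-amplifying algorithm for `N_{p^b}`).
  [GopalanGuruswamiLipton2007]
* S. Arora, B. Barak, *Computational Complexity: A Modern Approach*, CUP 2009, §1.3 (closure of
  polynomial time under composition and bounded loops). [AroraBarak2009]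
-/

namespace Literature.Computability.Complexity

open _root_.Computability Finset

namespace F2Sparse

/-! ### The arithmetic of the modular count -/

/-- **`f(y)` is the parity of `s(y)`, the number of monomials equal to `1` at `y`.** [folklore] -/
theorem eval_eq_bodd (mons : List (List ℕ)) (y : ℕ → Bool) :
    eval mons y = (mons.countP fun M => M.all y).bodd := by
  induction mons with
  | nil => simp
  | cons M mons ih =>
    rw [eval_cons, ih]
    simp only [List.countP_cons]
    cases M.all y
    · simp
    · simp [Nat.bodd_succ]

/-- `Σ_{a ∈ l} [p a]·s = #{a ∈ l : p a}·s`. [folklore] -/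
theorem sum_map_ite_const {α : Type*} (l : List α) (p : α → Bool) (s : ℕ) :
    (l.map fun a => if p a then s else 0).sum = l.countP p * s := by
  induction l with
  | nil => simp
  | cons a l ih =>
    rw [List.map_cons, List.sum_cons, ih, List.countP_cons]
    cases p a <;> simp [add_mul, add_comm]

/-- **Expanding the power.** The concatenated `k`-tuples of monomials are the `k`-th iterate of
`L ↦ [U ++ M | U ∈ L, M ∈ f]` from `[ε]` (`mᵏ` items; `x^U x^M` is `1` at `y` iff `x^{U ++ M}` is),
and the number of them equal to `1` at `y` is `s(y)ᵏ`. [folklore] -/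
theorem countP_iterate_tuples (mons : List (List ℕ)) (y : ℕ → Bool) : ∀ k : ℕ,
    ((fun L : List (List ℕ) => (L.map fun U => mons.map fun M => U ++ M).flatten)^[k] [[]]).countP
        (fun W => W.all y) = (mons.countP fun M => M.all y) ^ k
  | 0 => by simp
  | k + 1 => by
    rw [Function.iterate_succ_apply', List.countP_flatten, List.map_map, pow_succ,
      ← countP_iterate_tuples mons y k, ← sum_map_ite_const]
    congr 1
    refine List.map_congr_left fun U _ => ?_
    simp only [Function.comp_apply, List.countP_map]
    cases h : U.all y
    · simp [Function.comp_def, List.all_append, h]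
    · simp [Function.comp_def, List.all_append, h]

/-- **Exchange of summations**: summing over `y` the number of items of `l` selected by `p y` is
summing over the items the number of `y` selecting them. [folklore] -/
theorem sum_countP {ι α : Type*} (S : Finset ι) (p : ι → α → Bool) : ∀ l : List α,
    ∑ y ∈ S, l.countP (p y) = (l.map fun a => (S.filter fun y => p y a = true).card).sum
  | [] => by simp
  | a :: l => by
    simp only [List.countP_cons, List.map_cons, List.sum_cons, Finset.sum_add_distrib]
    rw [sum_countP S p l, Finset.card_filter, add_comm]

/-- `#{i < n : i ∉ W}` as a `Finset` cardinality and as the length of a filtered range. [folklore] -/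
theorem card_filter_range_not_mem (n : ℕ) (W : List ℕ) :
    ((Finset.range n).filter fun i => i ∉ W).card =
      ((List.range n).filter fun i => !decide (i ∈ W)).length := by
  rw [Finset.card_def, Finset.filter_val, Finset.range_val, ← Multiset.coe_range,
    Multiset.filter_coe, Multiset.coe_card]
  simp only [decide_not]

/-- **The subcube count in closed form**: `#{y ∈ 𝔽₂ⁿ : yᵢ = 1 ∀ i ∈ W}` (variables of index `≥ n`
read as `0`, as in `countZeros`) is `2^{#{i < n : i ∉ W}}` if every index of `W` is `< n`, and `0`
otherwise — the form the machine computes. [folklore] -/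
theorem card_subcube_eq (n : ℕ) (W : List ℕ) :
    (univ.filter fun y : Fin n → Bool =>
        W.all (fun i => if h : i < n then y ⟨i, h⟩ else false) = true).card =
      (if W.all (fun i => decide (i < n)) then
        2 ^ ((List.range n).filter fun i => !decide (i ∈ W)).length else 0) := by
  split_ifs with h
  · rw [List.all_eq_true] at h
    let t : Fin n → Finset Bool := fun j => if (j : ℕ) ∈ W then {true} else univ
    have hset : (univ.filter fun y : Fin n → Bool =>
        W.all (fun i => if h : i < n then y ⟨i, h⟩ else false) = true) = Fintype.piFinset t := by
      ext y
      simp only [mem_filter, mem_univ, true_and, Fintype.mem_piFinset, List.all_eq_true]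
      constructor
      · intro hy j
        by_cases hj : (j : ℕ) ∈ W
        · have hv := hy j hj
          simp only [j.isLt, dite_true, Fin.eta] at hv
          simp [t, hj, hv]
        · simp [t, hj]
      · intro hy i hi
        have hin : i < n := by simpa using h i hi
        have hv := hy ⟨i, hin⟩
        simp only [t, hi, if_true, mem_singleton] at hv
        simp [hin, hv]
    rw [hset, Fintype.card_piFinset]
    have ht : ∀ j : Fin n, (t j).card = if (j : ℕ) ∈ W then 1 else 2 := fun j => by
      by_cases hj : (j : ℕ) ∈ W <;> simp [t, hj]
    simp_rw [ht]
    rw [Fin.prod_univ_eq_prod_range (fun i => if i ∈ W then 1 else 2) n, prod_ite, prod_const_one,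
      one_mul, prod_const, card_filter_range_not_mem]
  · rw [Finset.card_eq_zero, filter_eq_empty_iff]
    intro y _ hy
    apply h
    rw [List.all_eq_true] at hy ⊢
    intro i hi
    have hv := hy i hi
    split_ifs at hv with hin
    · simpa using hin

/-- The odd case of the amplifier: `2^b ∣ s^{2^b} − 1` for odd `s`
(`s^{2^{b+1}} − 1 = (s^{2^b} − 1)(s^{2^b} + 1)`, the second factor even). [folklore] -/
theorem two_pow_dvd_pow_two_pow_sub_one {s : ℕ} (hs : Odd s) : ∀ b : ℕ, 2 ^ b ∣ s ^ 2 ^ b - 1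
  | 0 => by simp
  | b + 1 => by
    have ih := two_pow_dvd_pow_two_pow_sub_one hs b
    have htodd : Odd (s ^ 2 ^ b) := hs.pow
    obtain ⟨u, hu⟩ : ∃ u, s ^ 2 ^ b = u + 1 := ⟨s ^ 2 ^ b - 1, by have := htodd.pos; omega⟩
    have h2 : 2 ∣ u + 1 + 1 := by
      obtain ⟨r, hr⟩ := htodd
      exact ⟨r + 1, by omega⟩
    rw [hu, Nat.add_sub_cancel] at ih
    have hfac : s ^ 2 ^ (b + 1) - 1 = u * (u + 1 + 1) := by
      rw [pow_succ, pow_mul, hu]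
      have h' : (u + 1) ^ 2 = u * (u + 1 + 1) + 1 := by ring
      rw [h', Nat.add_sub_cancel]
    rw [hfac, pow_succ]
    exact mul_dvd_mul ih h2

/-- **The modulus amplifier at `p = 2`**: `s^{2^b} ≡ s mod 2 (mod 2^b)` for every natural `s`
(the degree-`2^b` instance of the modulus-amplifying polynomials of Toda / Yao / Beigel–Tarui used
by Gopalan–Guruswami–Lipton; cf. Wan 2008, pp. 2–3). [cite: Wan2007, §1 pp. 2–3 (modulus amplifying polynomials, GGL)] -/
theorem natCast_pow_two_pow_eq (s b : ℕ) :
    ((s ^ 2 ^ b : ℕ) : ZMod (2 ^ b)) = ((s % 2 : ℕ) : ZMod (2 ^ b)) := by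
  rcases Nat.even_or_odd s with ⟨r, hr⟩ | hs
  · have h0 : s % 2 = 0 := by omega
    rw [h0, Nat.cast_zero]
    have hdvd : 2 ^ b ∣ s ^ 2 ^ b := by
      have h1 : 2 ^ 2 ^ b ∣ s ^ 2 ^ b := pow_dvd_pow_of_dvd ⟨r, by omega⟩ _
      exact (pow_dvd_pow 2 (Nat.lt_two_pow_self).le).trans h1
    obtain ⟨c, hc⟩ := hdvd
    rw [hc, Nat.cast_mul, ZMod.natCast_self, zero_mul]
  · have h1 : s % 2 = 1 := Nat.odd_iff.mp hs
    rw [h1, Nat.cast_one]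
    obtain ⟨c, hc⟩ := two_pow_dvd_pow_two_pow_sub_one hs b
    have hpos : 1 ≤ s ^ 2 ^ b := Nat.one_le_pow _ _ hs.pos
    have h2 : s ^ 2 ^ b = 2 ^ b * c + 1 := by omega
    rw [h2, Nat.cast_add, Nat.cast_mul, ZMod.natCast_self, zero_mul, zero_add, Nat.cast_one]

/-- **Steps 1–3 assembled**: modulo `2^b`, the number of points where `f = 1` is the sum of the
`m^{2^b}` subcube counts (for any finite family of assignments `r y`). [cite: Wan2007, Theorem 1.1 (q = p = 2), via GGL pp. 2–3] -/
theorem natCast_card_eval_true {Y : Type*} [Fintype Y] (r : Y → ℕ → Bool) (b : ℕ)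
    (mons : List (List ℕ)) :
    (((univ.filter fun y : Y => eval mons (r y) = true).card : ℕ) : ZMod (2 ^ b)) =
      (((((fun L : List (List ℕ) => (L.map fun U => mons.map fun M => U ++ M).flatten)^[2 ^ b]
          [[]]).map fun W => (univ.filter fun y : Y => W.all (r y) = true).card).sum : ℕ) :
        ZMod (2 ^ b)) := by
  have h1 : (univ.filter fun y : Y => eval mons (r y) = true).card =
      ∑ y : Y, (mons.countP fun M => M.all (r y)) % 2 := by
    rw [Finset.card_filter]
    refine Finset.sum_congr rfl fun y _ => ?_
    rw [eval_eq_bodd, Nat.mod_two_of_bodd]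
    cases (mons.countP fun M => M.all (r y)).bodd <;> rfl
  have h2 : ∑ y : Y, (mons.countP fun M => M.all (r y)) ^ 2 ^ b =
      (((fun L : List (List ℕ) => (L.map fun U => mons.map fun M => U ++ M).flatten)^[2 ^ b]
          [[]]).map fun W => (univ.filter fun y : Y => W.all (r y) = true).card).sum := by
    simp_rw [← countP_iterate_tuples]
    exact sum_countP _ (fun (y : Y) (W : List ℕ) => W.all (r y)) _
  rw [h1, Nat.cast_sum, ← h2, Nat.cast_sum]
  exact Finset.sum_congr rfl fun y _ => (natCast_pow_two_pow_eq _ b).symm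

/-- **Step 4, the formula the machine evaluates**:
`N(f) mod 2^b = (2ⁿ + (2^b − 1) · Σ_W c_n(W)) mod 2^b`, the sum over the concatenated `2^b`-tuples
`W` of monomials of the closed-form subcube counts `c_n(W)`. [cite: Wan2007, Theorem 1.1 (q = p = 2); GopalanGuruswamiLipton2007] -/
theorem countZeros_mod_two_pow (n b : ℕ) (mons : List (List ℕ)) :
    countZeros n mons % 2 ^ b =
      (2 ^ n + (2 ^ b - 1) *
        (((fun L : List (List ℕ) => (L.map fun U => mons.map fun M => U ++ M).flatten)^[2 ^ b]
            [[]]).map fun W => if W.all (fun i => decide (i < n)) then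
              2 ^ ((List.range n).filter fun i => !decide (i ∈ W)).length else 0).sum) % 2 ^ b := by
  set L := (fun L : List (List ℕ) => (L.map fun U => mons.map fun M => U ++ M).flatten)^[2 ^ b] [[]]
    with hL
  have hmap : (L.map fun W => if W.all (fun i => decide (i < n)) then
        2 ^ ((List.range n).filter fun i => !decide (i ∈ W)).length else 0) =
      L.map fun W => (univ.filter fun y : Fin n → Bool =>
        W.all (fun i => if h : i < n then y ⟨i, h⟩ else false) = true).card :=
    List.map_congr_left fun W _ => (card_subcube_eq n W).symm
  rw [hmap, ← ZMod.natCast_eq_natCast_iff']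
  have hcz : countZeros n mons = (univ.filter fun y : Fin n → Bool =>
      eval mons (fun i => if h : i < n then y ⟨i, h⟩ else false) = false).card := rfl
  set A := (L.map fun W => (univ.filter fun y : Fin n → Bool =>
    W.all (fun i => if h : i < n then y ⟨i, h⟩ else false) = true).card).sum with hA
  set T := (univ.filter fun y : Fin n → Bool =>
    eval mons (fun i => if h : i < n then y ⟨i, h⟩ else false) = true).card with hT
  have hNT : countZeros n mons + T = 2 ^ n := by
    have h := Finset.card_filter_add_card_filter_not (s := (univ : Finset (Fin n → Bool)))
      (fun y => eval mons (fun i => if h : i < n then y ⟨i, h⟩ else false) = false)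
    rw [Finset.card_univ, Fintype.card_fun, Fintype.card_bool, Fintype.card_fin] at h
    rw [hcz, hT, ← h]
    congr 2
    exact Finset.filter_congr fun y _ => by simp
  have hN : countZeros n mons = 2 ^ n - T := by omega
  have hTle : T ≤ 2 ^ n := by omega
  have hTA : (T : ZMod (2 ^ b)) = (A : ZMod (2 ^ b)) :=
    natCast_card_eval_true (fun (y : Fin n → Bool) i => if h : i < n then y ⟨i, h⟩ else false) b mons
  have h2b : ((2 ^ b : ℕ) : ZMod (2 ^ b)) = 0 := ZMod.natCast_self _
  rw [hN, Nat.cast_sub hTle, Nat.cast_add, Nat.cast_mul, Nat.cast_sub Nat.one_le_two_pow, hTA, h2b]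
  push_cast
  ring

end F2Sparse

/-! ### The machine: a `CodeFP` program -/

namespace Wan2008Proof

open CodeFP F2Sparse

/-- One round of the tuple enumeration, `(f, L) ↦ [U ++ M | U ∈ L, M ∈ f]`, on raw codes
(monomials as raw lists of binary indices, `rawE (rawE natE)`). [folklore] -/
theorem codeFP_step : CodeFP (pairE (rawE (rawE natE)) (rawE (rawE natE))) (rawE (rawE natE))
    (fun p => (p.2.map fun U => p.1.map fun M => U ++ M).flatten) := by
  have hin : CodeFP (pairE (rawE natE) (rawE (rawE natE))) (rawE (rawE natE))
      (fun p => p.2.map fun M => p.1 ++ M) :=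
    map (σ := List ℕ) (α := List ℕ) (g := fun q : List ℕ × List ℕ => q.1 ++ q.2) (rawAppend natE)
  have hout : CodeFP (pairE (rawE (rawE natE)) (rawE (rawE natE))) (rawE (rawE (rawE natE)))
      (fun p => p.2.map fun U => p.1.map fun M => U ++ M) :=
    map (σ := List (List ℕ)) (α := List ℕ)
      (g := fun q : List (List ℕ) × List ℕ => q.1.map fun M => q.2 ++ M)
      (hin.comp ((snd (rawE (rawE natE)) (rawE natE)).pair (fst (rawE (rawE natE)) (rawE natE))))
  exact (flatten (rawE natE)).comp hout

/-- The `k`-fold tuple enumeration is computed on codes (a `k`-fold composition).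
[cite: AroraBarak2009, §1.3 (composition of polynomial-time maps)] -/
theorem codeFP_tuples : ∀ k : ℕ, CodeFP (rawE (rawE natE)) (rawE (rawE natE))
    (fun mons => (fun L : List (List ℕ) => (L.map fun U => mons.map fun M => U ++ M).flatten)^[k] [[]])
  | 0 => (const (rawE (rawE natE)) ([[]] : List (List ℕ))).congr fun _ => rfl
  | k + 1 => (codeFP_step.comp ((CodeFP.id _).pair (codeFP_tuples k))).congr fun mons => by
      rw [Function.iterate_succ_apply']; rfl

/-- The closed-form subcube count `(1ⁿ, W) ↦ c_n(W)` is computed on codes. [folklore] -/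
theorem codeFP_subcube : CodeFP (pairE unE (rawE natE)) natE
    (fun p => if p.2.all (fun i => decide (i < p.1)) then
      2 ^ ((List.range p.1).filter fun i => !decide (i ∈ p.2)).length else 0) := by
  have hlt : CodeFP (pairE unE natE) bitE (fun q => decide (q.2 < q.1)) :=
    natLt.comp ((snd unE natE).pair (natOfUn.comp (fst unE natE)))
  have hall : CodeFP (pairE unE (rawE natE)) bitE (fun p => p.2.all fun i => decide (i < p.1)) :=
    all hlt
  have hnm : CodeFP (pairE (rawE natE) natE) bitE (fun q => !decide (q.2 ∈ q.1)) :=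
    ((mem natE_injective).comp ((snd (rawE natE) natE).pair (fst (rawE natE) natE))).not
  have hfil : CodeFP (pairE (rawE natE) (rawE natE)) (rawE natE)
      (fun q => q.2.filter fun i => !decide (i ∈ q.1)) :=
    filter hnm
  have hfree : CodeFP (pairE unE (rawE natE)) unE
      (fun p => ((List.range p.1).filter fun i => !decide (i ∈ p.2)).length) :=
    (ulength natE).comp (hfil.comp ((snd unE (rawE natE)).pair (urange.comp (fst unE (rawE natE)))))
  have hpow : CodeFP (pairE unE (rawE natE)) natE
      (fun p => 2 ^ ((List.range p.1).filter fun i => !decide (i ∈ p.2)).length) :=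
    natPow.comp ((const _ 2).pair hfree)
  exact hall.ite hpow (const _ 0)

/-- **The whole program**: `⟨1ⁿ, f⟩ ↦ N(f) mod 2^b` is computed on codes (input code
`pairE unE (listE (listE natE))`, the `encode` of `unaryEncodingNat.pairBool
encodingNatBool.listBool.listBool`), for every fixed `b`. [cite: Wan2007, Theorem 1.1 (q = p = 2, h = 1); GopalanGuruswamiLipton2007] -/
theorem codeFP_main (b : ℕ) :
    CodeFP (pairE unE (listE (listE natE))) natE (fun p => countZeros p.1 p.2 % 2 ^ b) := by
  -- sums of raw lists of naturals, through the integer fold `intSum` (as in the tree's other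
  -- `CodeFP` clients; kept local to this proof)
  have hsum : CodeFP (rawE natE) natE List.sum :=
    (intToNat.comp (intSum.comp (map₀ intOfNat))).congr fun l => by
      show ((l.map fun n : ℕ => (n : ℤ)).sum).toNat = l.sum
      rw [← Nat.cast_list_sum, Int.toNat_natCast]
  have hn : CodeFP (pairE unE (listE (listE natE))) unE (fun p => p.1) := fst _ _
  have hmons : CodeFP (pairE unE (listE (listE natE))) (rawE (rawE natE)) (fun p => p.2) :=
    ((map₀ (rawOfList natE)).comp ((rawOfList (listE natE)).comp
      (snd unE (listE (listE natE))))).congr fun p => by simp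
  have htup : CodeFP (pairE unE (listE (listE natE))) (rawE (rawE natE))
      (fun p => (fun L : List (List ℕ) => (L.map fun U => p.2.map fun M => U ++ M).flatten)^[2 ^ b]
        [[]]) :=
    (codeFP_tuples (2 ^ b)).comp hmons
  have hA : CodeFP (pairE unE (listE (listE natE))) natE
      (fun p => (((fun L : List (List ℕ) => (L.map fun U => p.2.map fun M => U ++ M).flatten)^[2 ^ b]
        [[]]).map fun W => if W.all (fun i => decide (i < p.1)) then
          2 ^ ((List.range p.1).filter fun i => !decide (i ∈ W)).length else 0).sum) :=
    hsum.comp ((map codeFP_subcube).comp (hn.pair htup))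
  have h2n : CodeFP (pairE unE (listE (listE natE))) natE (fun p => 2 ^ p.1) :=
    natPow.comp ((const _ 2).pair hn)
  have hval : CodeFP (pairE unE (listE (listE natE))) natE
      (fun p => (2 ^ p.1 + (2 ^ b - 1) *
        (((fun L : List (List ℕ) => (L.map fun U => p.2.map fun M => U ++ M).flatten)^[2 ^ b]
          [[]]).map fun W => if W.all (fun i => decide (i < p.1)) then
            2 ^ ((List.range p.1).filter fun i => !decide (i ∈ W)).length else 0).sum) % 2 ^ b) :=
    natMod.comp ((natAdd.comp (h2n.pair (natMul.comp ((const _ (2 ^ b - 1)).pair hA)))).pair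
      (const _ (2 ^ b)))
  exact hval.congr fun p => (countZeros_mod_two_pow p.1 b p.2).symm

end Wan2008Proof

/-- **Wan 2008, Theorem 1.1 at `q = p = 2`, `h = 1` — discharged**: for every fixed `b`, counting
the zeros of a sparse polynomial over `𝔽₂` modulo `2^b` is polynomial time (`⟨1ⁿ, f⟩ ↦ N(f) mod 2^b`
is `PolyTimeComputable` between the encodings of the fact). Proved along the elementary
modulus-amplifying route of Gopalan–Guruswami–Lipton recalled by Wan (pp. 2–3) rather than the
printed `p`-adic one (Gauss sums, Stickelberger, Gross–Koblitz), see the module docstring. [cite: Wan2007, Theorem 1.1 (q = p = 2, h = 1); GopalanGuruswamiLipton2007] -/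
theorem Wan2008_countZerosModTwoPow_polyTime_holds : Wan2008_countZerosModTwoPow_polyTime := by
  intro b
  rw [CodeFP.pairE_eq, CodeFP.unE_eq, CodeFP.listE_eq, CodeFP.listE_eq, CodeFP.natE_eq]
  exact (Wan2008Proof.codeFP_main b).polyTimeComputable

end Literature.Computability.Complexity
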